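import Literature.NumberTheory.LFunctions.HyperbolicSeparationIndicator
import Literature.NumberTheory.LFunctions.TwistedDirichletPolynomialMeanValue
import HarnessLib

/-!
# The separated bilinear discrete mean value over a hyperbola

Third file of the separation-of-variables step of Conrey–Iwaniec, *Spacing of zeros of Hecke
L-functions and the class number problem*, Acta Arith. 103 (2002), §9 p. 20, proof of
Proposition 9.1: for `B(s) = Σ_{m,n ≤ q⁴, mn > q⁴} λ*(m)λ(n)(mn)^{−s}`, "we relax the condition `mn > q⁴`
by any method of separation of variables … This separation costs us a factor `log q`. It follows
that `Σ_s |B(s)| ≪ T(log q)²(Σ_m τ²(m,χ)m^{−1})^{1/2}(Σ_n τ²(n)n^{−1})^{1/2}`" (the discrete mean value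
theorem, "Lemma 5.3", for each factor and Cauchy's inequality). Everything here is PROVED, in the
generic form: for coefficients `a` on `[M₁,M₂] ⊂ [1,N]`, `b` on `[N₁,N₂] ⊂ [1,N]`, a threshold
`X ≥ 2`, and `1`-spaced points `t ∈ [−2T, 2T]` with `N ≤ T`,
`Σ_t |Σ_{mn > X} a_m m^{−s} b_n n^{−s}| ≤ 186·T(1 + log N)(1 + log X)(Σ|a_m|²/m)^{1/2}(Σ|b_n|²/n)^{1/2}`,
`s = ½ + it` (`sum_norm_hyperbolic_bilinear_le`). Ingredients: the exact Mellin separation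
(`HyperbolicSeparation.integral_kernel_mul_cpow`, kernel mass `≤ 30(1 + log X)`), the tree's
`Gallagher.discreteMeanValue` with the twist `m^{−c−iu}` absorbed into the coefficients, Cauchy.

## References
* [ConreyIwaniec2002] B. Conrey, H. Iwaniec, Acta Arith. 103 (2002) 259–312, §9 p. 20; Lemma 5.3.
* [Huxley1972] M. N. Huxley, *The Distribution of Prime Numbers*, Ch. 18 (18.29).
-/

noncomputable section

open Complex MeasureTheory Real Filter

namespace Literature.NumberTheory.LFunctions

namespace HyperbolicSeparation

/-! ### The separation identity for the hyperbolic bilinear sum -/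

/-- `‖k^{−z}‖ ≤ 1` for `k ≥ 1` and `Re z ≥ 0`. [folklore] -/
private theorem norm_natCast_cpow_neg_le_one' {m : ℕ} (hm : 1 ≤ m) {z : ℂ} (hz : 0 ≤ z.re) :
    ‖(m : ℂ) ^ (-z)‖ ≤ 1 := by
  rw [Complex.norm_natCast_cpow_of_pos (by omega), Complex.neg_re]
  exact Real.rpow_le_one_of_one_le_of_nonpos (by exact_mod_cast hm) (by linarith)

/-- `u ↦ κ_X(u)·k^{−(c+iu)}` is integrable for `k ≥ 1`.
[cite: ConreyIwaniec2002, §9 p. 20 (separation of variables in mn > q⁴)] -/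
theorem integrable_kernel_mul_cpow {X k : ℕ} (hX : 1 ≤ X) (hk : 1 ≤ k) {c : ℝ} (hc : 0 < c) :
    Integrable fun u : ℝ =>
      ((((X : ℝ) + 1 : ℝ) : ℂ) ^ (1 + ((c : ℂ) + u * I)) - ((X : ℝ) : ℂ) ^ (1 + ((c : ℂ) + u * I))) /
          (((c : ℂ) + u * I) * ((c : ℂ) + u * I + 1)) * (k : ℂ) ^ (-((c : ℂ) + u * I)) := by
  have hXr : (1 : ℝ) ≤ (X : ℝ) := by exact_mod_cast hX
  have hk0 : (k : ℂ) ≠ 0 := by exact_mod_cast (show k ≠ 0 by omega)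
  have hcont : Continuous fun u : ℝ => (k : ℂ) ^ (-((c : ℂ) + u * I)) :=
    (Continuous.neg (by fun_prop)).const_cpow (Or.inl hk0)
  refine (integrable_kernel hXr hc).mul_bdd (c := 1) hcont.aestronglyMeasurable
    (ae_of_all _ fun u => ?_)
  exact norm_natCast_cpow_neg_le_one' hk (by simp [hc.le])

/-- **The separation identity.** For `[M₁,M₂], [N₁,N₂] ⊂ [1,∞)`, an integer threshold `X ≥ 1`,
`c > 0` and any `s`:
`Σ_{m,n: mn > X} a_m m^{−s} b_n n^{−s} = (Σ_m a_m m^{−s})(Σ_n b_n n^{−s})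
  − (1/2π)∫ κ_X(u)·(Σ_m a_m m^{−s}m^{−c−iu})(Σ_n b_n n^{−s}n^{−c−iu}) du`
("we relax the condition `mn > q⁴` by any method of separation of variables").
[cite: ConreyIwaniec2002, §9 p. 20 (separation of variables in mn > q⁴)] -/
theorem hyperbolic_sum_eq (a b : ℕ → ℂ) {M₁ M₂ N₁ N₂ X : ℕ} (hM : 1 ≤ M₁) (hN : 1 ≤ N₁)
    (hX : 1 ≤ X) {c : ℝ} (hc : 0 < c) (s : ℂ) :
    (∑ m ∈ Finset.Icc M₁ M₂, ∑ n ∈ Finset.Icc N₁ N₂,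
        if X < m * n then a m * (m : ℂ) ^ (-s) * (b n * (n : ℂ) ^ (-s)) else 0) =
      (∑ m ∈ Finset.Icc M₁ M₂, a m * (m : ℂ) ^ (-s)) *
          (∑ n ∈ Finset.Icc N₁ N₂, b n * (n : ℂ) ^ (-s)) -
        (1 / (2 * Real.pi) : ℂ) * ∫ u : ℝ,
          ((((X : ℝ) + 1 : ℝ) : ℂ) ^ (1 + ((c : ℂ) + u * I)) - ((X : ℝ) : ℂ) ^ (1 + ((c : ℂ) + u * I))) /
          (((c : ℂ) + u * I) * ((c : ℂ) + u * I + 1)) *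
          ((∑ m ∈ Finset.Icc M₁ M₂, a m * (m : ℂ) ^ (-s) * (m : ℂ) ^ (-((c : ℂ) + u * I))) *
            (∑ n ∈ Finset.Icc N₁ N₂, b n * (n : ℂ) ^ (-s) * (n : ℂ) ^ (-((c : ℂ) + u * I)))) := by
  -- the indicator, term by term
  have hind : ∀ m ∈ Finset.Icc M₁ M₂, ∀ n ∈ Finset.Icc N₁ N₂,
      (if X < m * n then a m * (m : ℂ) ^ (-s) * (b n * (n : ℂ) ^ (-s)) else 0) =
        a m * (m : ℂ) ^ (-s) * (b n * (n : ℂ) ^ (-s)) -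
        a m * (m : ℂ) ^ (-s) * (b n * (n : ℂ) ^ (-s)) *
          ((1 / (2 * Real.pi) : ℂ) * ∫ u : ℝ,
            ((((X : ℝ) + 1 : ℝ) : ℂ) ^ (1 + ((c : ℂ) + u * I)) - ((X : ℝ) : ℂ) ^ (1 + ((c : ℂ) + u * I))) /
          (((c : ℂ) + u * I) * ((c : ℂ) + u * I + 1)) * ((m * n : ℕ) : ℂ) ^ (-((c : ℂ) + u * I))) := by
    intro m hm n hn
    have hm1 : 1 ≤ m := hM.trans (Finset.mem_Icc.mp hm).1
    have hn1 : 1 ≤ n := hN.trans (Finset.mem_Icc.mp hn).1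
    rw [integral_kernel_mul_cpow hX (Nat.one_le_iff_ne_zero.mpr (Nat.mul_ne_zero
      (by omega) (by omega))) hc]
    by_cases h : X < m * n
    · rw [if_pos h, if_neg (by omega)]; ring
    · rw [if_neg h, if_pos (by omega)]; ring
  -- integrability of each separated term
  have hI : ∀ m ∈ Finset.Icc M₁ M₂, ∀ n ∈ Finset.Icc N₁ N₂, Integrable fun u : ℝ =>
      a m * (m : ℂ) ^ (-s) * (b n * (n : ℂ) ^ (-s)) *
        (((((X : ℝ) + 1 : ℝ) : ℂ) ^ (1 + ((c : ℂ) + u * I)) - ((X : ℝ) : ℂ) ^ (1 + ((c : ℂ) + u * I))) /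
          (((c : ℂ) + u * I) * ((c : ℂ) + u * I + 1)) * ((m * n : ℕ) : ℂ) ^ (-((c : ℂ) + u * I))) := by
    intro m hm n hn
    have hm1 : 1 ≤ m := hM.trans (Finset.mem_Icc.mp hm).1
    have hn1 : 1 ≤ n := hN.trans (Finset.mem_Icc.mp hn).1
    exact (integrable_kernel_mul_cpow hX (Nat.one_le_iff_ne_zero.mpr (Nat.mul_ne_zero
      (by omega) (by omega))) hc).const_mul _
  rw [Finset.sum_congr rfl fun m hm => Finset.sum_congr rfl fun n hn => hind m hm n hn]
  simp only [Finset.sum_sub_distrib]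
  congr 1
  · exact (Finset.sum_mul_sum _ _ _ _).symm
  · -- pull the constant and the integral out of the double sum
    have h1 : ∀ m ∈ Finset.Icc M₁ M₂, ∀ n ∈ Finset.Icc N₁ N₂,
        a m * (m : ℂ) ^ (-s) * (b n * (n : ℂ) ^ (-s)) *
          ((1 / (2 * Real.pi) : ℂ) * ∫ u : ℝ,
            ((((X : ℝ) + 1 : ℝ) : ℂ) ^ (1 + ((c : ℂ) + u * I)) - ((X : ℝ) : ℂ) ^ (1 + ((c : ℂ) + u * I))) /
          (((c : ℂ) + u * I) * ((c : ℂ) + u * I + 1)) * ((m * n : ℕ) : ℂ) ^ (-((c : ℂ) + u * I))) =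
        (1 / (2 * Real.pi) : ℂ) * ∫ u : ℝ, a m * (m : ℂ) ^ (-s) * (b n * (n : ℂ) ^ (-s)) *
          (((((X : ℝ) + 1 : ℝ) : ℂ) ^ (1 + ((c : ℂ) + u * I)) - ((X : ℝ) : ℂ) ^ (1 + ((c : ℂ) + u * I))) /
          (((c : ℂ) + u * I) * ((c : ℂ) + u * I + 1)) * ((m * n : ℕ) : ℂ) ^ (-((c : ℂ) + u * I))) := by
      intro m _ n _
      rw [mul_left_comm, ← integral_const_mul]
    rw [Finset.sum_congr rfl fun m hm => Finset.sum_congr rfl fun n hn => h1 m hm n hn]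
    simp only [← Finset.mul_sum]
    congr 1
    have h2 : ∀ m ∈ Finset.Icc M₁ M₂,
        ∑ n ∈ Finset.Icc N₁ N₂, ∫ u : ℝ, a m * (m : ℂ) ^ (-s) * (b n * (n : ℂ) ^ (-s)) *
          (((((X : ℝ) + 1 : ℝ) : ℂ) ^ (1 + ((c : ℂ) + u * I)) - ((X : ℝ) : ℂ) ^ (1 + ((c : ℂ) + u * I))) /
          (((c : ℂ) + u * I) * ((c : ℂ) + u * I + 1)) * ((m * n : ℕ) : ℂ) ^ (-((c : ℂ) + u * I))) =
        ∫ u : ℝ, ∑ n ∈ Finset.Icc N₁ N₂, a m * (m : ℂ) ^ (-s) * (b n * (n : ℂ) ^ (-s)) *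
          (((((X : ℝ) + 1 : ℝ) : ℂ) ^ (1 + ((c : ℂ) + u * I)) - ((X : ℝ) : ℂ) ^ (1 + ((c : ℂ) + u * I))) /
          (((c : ℂ) + u * I) * ((c : ℂ) + u * I + 1)) * ((m * n : ℕ) : ℂ) ^ (-((c : ℂ) + u * I))) :=
      fun m hm => (integral_finsetSum _ fun n hn => hI m hm n hn).symm
    rw [Finset.sum_congr rfl h2,
      ← integral_finsetSum _ fun m hm => integrable_finsetSum _ fun n hn => hI m hm n hn]
    refine integral_congr_ae (ae_of_all _ fun u => ?_)
    -- pointwise in `u`: the double sum is `κ(u)·P_a^u·P_b^u`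
    beta_reduce
    rw [Finset.sum_mul_sum, Finset.mul_sum]
    refine Finset.sum_congr rfl fun m _ => ?_
    rw [Finset.mul_sum]
    refine Finset.sum_congr rfl fun n _ => ?_
    rw [Nat.cast_mul, Complex.natCast_mul_natCast_cpow]
    ring

/-! ### The pointwise bound and the mean value over the points -/

/-- `‖1/(2π)‖ = 1/(2π)` in `ℂ`. [folklore] -/
private theorem norm_one_div_two_pi : ‖(1 / (2 * Real.pi) : ℂ)‖ = 1 / (2 * Real.pi) := by
  rw [show (1 / (2 * Real.pi) : ℂ) = ((1 / (2 * Real.pi) : ℝ) : ℂ) by push_cast; ring,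
    Complex.norm_real, Real.norm_of_nonneg (by positivity)]

/-- **Pointwise bound after separation**: for `s = ½ + it`,
`|Σ_{mn>X} a_m m^{−s} b_n n^{−s}| ≤ |P_a(s)||P_b(s)| + (1/2π)∫ |κ_X(u)|·|P_a^u(s)||P_b^u(s)| du`.
[cite: ConreyIwaniec2002, §9 p. 20 (separation of variables in mn > q⁴)] -/
theorem norm_hyperbolic_sum_le (a b : ℕ → ℂ) {M₁ M₂ N₁ N₂ X : ℕ} (hM : 1 ≤ M₁) (hN : 1 ≤ N₁)
    (hX : 1 ≤ X) {c : ℝ} (hc : 0 < c) (t : ℝ) :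
    ‖(∑ m ∈ Finset.Icc M₁ M₂, ∑ n ∈ Finset.Icc N₁ N₂,
        if X < m * n then a m * (m : ℂ) ^ (-(1 / 2 + t * I)) * (b n * (n : ℂ) ^ (-(1 / 2 + t * I))) else 0)‖ ≤
      ‖(∑ m ∈ Finset.Icc M₁ M₂, a m * (m : ℂ) ^ (-(1 / 2 + t * I)))‖ * ‖(∑ n ∈ Finset.Icc N₁ N₂, b n * (n : ℂ) ^ (-(1 / 2 + t * I)))‖ +
        1 / (2 * Real.pi) * ∫ u : ℝ, ‖((((X : ℝ) + 1 : ℝ) : ℂ) ^ (1 + ((c : ℂ) + u * I)) - ((X : ℝ) : ℂ) ^ (1 + ((c : ℂ) + u * I))) /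
          (((c : ℂ) + u * I) * ((c : ℂ) + u * I + 1))‖ * (‖(∑ m ∈ Finset.Icc M₁ M₂, a m * (m : ℂ) ^ (-(1 / 2 + t * I)) * (m : ℂ) ^ (-((c : ℂ) + u * I)))‖ * ‖(∑ n ∈ Finset.Icc N₁ N₂, b n * (n : ℂ) ^ (-(1 / 2 + t * I)) * (n : ℂ) ^ (-((c : ℂ) + u * I)))‖) := by
  rw [hyperbolic_sum_eq a b hM hN hX hc]
  refine (norm_sub_le _ _).trans (add_le_add (le_of_eq (norm_mul _ _)) ?_)
  rw [norm_mul, norm_one_div_two_pi]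
  refine mul_le_mul_of_nonneg_left ?_ (by positivity)
  refine (norm_integral_le_integral_norm _).trans (le_of_eq ?_)
  refine integral_congr_ae (ae_of_all _ fun u => ?_)
  simp only [norm_mul]

/-- The integrand `|κ_X(u)|·|P_a^u(½+it)||P_b^u(½+it)|` is integrable in `u` (the polynomials are
bounded by `Σ|a_m|`, `Σ|b_n|`). [cite: ConreyIwaniec2002, §9 p. 20 (separation of variables in mn > q⁴)] -/
theorem integrable_norm_kernel_mul_polys (a b : ℕ → ℂ) {M₁ M₂ N₁ N₂ X : ℕ} (hM : 1 ≤ M₁)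
    (hN : 1 ≤ N₁) (hX : 1 ≤ X) {c : ℝ} (hc : 0 < c) (t : ℝ) :
    Integrable fun u : ℝ => ‖((((X : ℝ) + 1 : ℝ) : ℂ) ^ (1 + ((c : ℂ) + u * I)) - ((X : ℝ) : ℂ) ^ (1 + ((c : ℂ) + u * I))) /
          (((c : ℂ) + u * I) * ((c : ℂ) + u * I + 1))‖ * (‖(∑ m ∈ Finset.Icc M₁ M₂, a m * (m : ℂ) ^ (-(1 / 2 + t * I)) * (m : ℂ) ^ (-((c : ℂ) + u * I)))‖ * ‖(∑ n ∈ Finset.Icc N₁ N₂, b n * (n : ℂ) ^ (-(1 / 2 + t * I)) * (n : ℂ) ^ (-((c : ℂ) + u * I)))‖) := by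
  have hXr : (1 : ℝ) ≤ (X : ℝ) := by exact_mod_cast hX
  have hs : 0 ≤ (1 / 2 + (t : ℂ) * I).re := by simp
  have hz : ∀ u : ℝ, 0 ≤ (((c : ℂ) + u * I)).re := fun u => by simp [hc.le]
  have hcont : Continuous fun u : ℝ => ‖(∑ m ∈ Finset.Icc M₁ M₂, a m * (m : ℂ) ^ (-(1 / 2 + t * I)) * (m : ℂ) ^ (-((c : ℂ) + u * I)))‖ * ‖(∑ n ∈ Finset.Icc N₁ N₂, b n * (n : ℂ) ^ (-(1 / 2 + t * I)) * (n : ℂ) ^ (-((c : ℂ) + u * I)))‖ :=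
    ((continuous_twistedPoly a hM _ c).norm).mul ((continuous_twistedPoly b hN _ c).norm)
  refine ((integrable_kernel hXr hc).norm).mul_bdd
    (c := (∑ m ∈ Finset.Icc M₁ M₂, ‖a m‖) * ∑ n ∈ Finset.Icc N₁ N₂, ‖b n‖)
    hcont.aestronglyMeasurable (ae_of_all _ fun u => ?_)
  rw [Real.norm_of_nonneg (by positivity)]
  exact mul_le_mul (norm_twistedPoly_le a hM hs (hz u)) (norm_twistedPoly_le b hN hs (hz u))
    (norm_nonneg _) (Finset.sum_nonneg fun _ _ => norm_nonneg _)

/-- **The averaged off-diagonal bound**: for `1`-spaced `t ∈ S ⊂ [−2T,2T]`, `N ≤ T`,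
`∫ |κ_X(u)| Σ_t |P_a^u||P_b^u| du ≤ 31T(1+log N)(Σ|a|²/m)^{1/2}(Σ|b|²/n)^{1/2}·∫|κ_X|`
(Cauchy over `t`, then "Lemma 5.3" for each twisted factor).
[cite: ConreyIwaniec2002, §9 p. 20 (separation of variables in mn > q⁴); Lemma 5.3] -/
theorem integral_sum_norm_le (a b : ℕ → ℂ) {N M₁ M₂ N₁ N₂ X : ℕ} (hM : 1 ≤ M₁) (hMN : M₂ ≤ N)
    (hN : 1 ≤ N₁) (hNN : N₂ ≤ N) (hX : 1 ≤ X) {c : ℝ} (hc : 0 < c) {T : ℝ} (hT : 0 < T)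
    (hNT : (N : ℝ) ≤ T) (S : Finset ℝ) (hmem : ∀ t ∈ S, |t| ≤ 2 * T)
    (hsep : ∀ t ∈ S, ∀ t' ∈ S, t ≠ t' → (1 : ℝ) ≤ |t - t'|) :
    ∫ u : ℝ, ∑ t ∈ S, ‖((((X : ℝ) + 1 : ℝ) : ℂ) ^ (1 + ((c : ℂ) + u * I)) - ((X : ℝ) : ℂ) ^ (1 + ((c : ℂ) + u * I))) /
          (((c : ℂ) + u * I) * ((c : ℂ) + u * I + 1))‖ * (‖(∑ m ∈ Finset.Icc M₁ M₂, a m * (m : ℂ) ^ (-(1 / 2 + t * I)) * (m : ℂ) ^ (-((c : ℂ) + u * I)))‖ * ‖(∑ n ∈ Finset.Icc N₁ N₂, b n * (n : ℂ) ^ (-(1 / 2 + t * I)) * (n : ℂ) ^ (-((c : ℂ) + u * I)))‖) ≤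
      (31 * T * (1 + Real.log N) * Real.sqrt (∑ m ∈ Finset.Icc M₁ M₂, ‖a m‖ ^ 2 / m) *
        Real.sqrt (∑ n ∈ Finset.Icc N₁ N₂, ‖b n‖ ^ 2 / n)) *
      ∫ u : ℝ, ‖((((X : ℝ) + 1 : ℝ) : ℂ) ^ (1 + ((c : ℂ) + u * I)) - ((X : ℝ) : ℂ) ^ (1 + ((c : ℂ) + u * I))) /
          (((c : ℂ) + u * I) * ((c : ℂ) + u * I + 1))‖ := by
  have hXr : (1 : ℝ) ≤ (X : ℝ) := by exact_mod_cast hX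
  set G : ℝ := 31 * T * (1 + Real.log N) with hG
  set A : ℝ := ∑ m ∈ Finset.Icc M₁ M₂, ‖a m‖ ^ 2 / m with hA
  set B : ℝ := ∑ n ∈ Finset.Icc N₁ N₂, ‖b n‖ ^ 2 / n with hB
  have hlogN : 0 ≤ Real.log N := Real.log_natCast_nonneg N
  have hG0 : 0 ≤ G := by positivity
  have hz : ∀ u : ℝ, 0 ≤ (((c : ℂ) + u * I)).re := fun u => by simp [hc.le]
  -- pointwise in `u`: Cauchy over `t` and the twisted mean values
  have hpt : ∀ u : ℝ, ∑ t ∈ S, ‖((((X : ℝ) + 1 : ℝ) : ℂ) ^ (1 + ((c : ℂ) + u * I)) - ((X : ℝ) : ℂ) ^ (1 + ((c : ℂ) + u * I))) /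
          (((c : ℂ) + u * I) * ((c : ℂ) + u * I + 1))‖ * (‖(∑ m ∈ Finset.Icc M₁ M₂, a m * (m : ℂ) ^ (-(1 / 2 + t * I)) * (m : ℂ) ^ (-((c : ℂ) + u * I)))‖ * ‖(∑ n ∈ Finset.Icc N₁ N₂, b n * (n : ℂ) ^ (-(1 / 2 + t * I)) * (n : ℂ) ^ (-((c : ℂ) + u * I)))‖) ≤
      (G * Real.sqrt A * Real.sqrt B) * ‖((((X : ℝ) + 1 : ℝ) : ℂ) ^ (1 + ((c : ℂ) + u * I)) - ((X : ℝ) : ℂ) ^ (1 + ((c : ℂ) + u * I))) /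
          (((c : ℂ) + u * I) * ((c : ℂ) + u * I + 1))‖ := by
    intro u
    rw [← Finset.mul_sum, mul_comm]
    refine mul_le_mul_of_nonneg_right ?_ (norm_nonneg _)
    have hCS := sum_norm_mul_le_sqrt S
      (fun t : ℝ => (∑ m ∈ Finset.Icc M₁ M₂, a m * (m : ℂ) ^ (-(1 / 2 + t * I)) * (m : ℂ) ^ (-((c : ℂ) + u * I)))) (fun t : ℝ => (∑ n ∈ Finset.Icc N₁ N₂, b n * (n : ℂ) ^ (-(1 / 2 + t * I)) * (n : ℂ) ^ (-((c : ℂ) + u * I))))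
    simp only [norm_mul] at hCS
    refine hCS.trans ?_
    have ha := sum_norm_sq_twistedPoly_le a hM hMN hT hNT S hmem hsep (hz u)
    have hb := sum_norm_sq_twistedPoly_le b hN hNN hT hNT S hmem hsep (hz u)
    calc _ ≤ Real.sqrt (G * A) * Real.sqrt (G * B) := by
          gcongr
      _ = G * Real.sqrt A * Real.sqrt B := by
          rw [Real.sqrt_mul hG0, Real.sqrt_mul hG0]
          have := Real.mul_self_sqrt hG0
          calc Real.sqrt G * Real.sqrt A * (Real.sqrt G * Real.sqrt B)
              = (Real.sqrt G * Real.sqrt G) * Real.sqrt A * Real.sqrt B := by ring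
            _ = G * Real.sqrt A * Real.sqrt B := by rw [this]
  have hint : Integrable fun u : ℝ => ∑ t ∈ S, ‖((((X : ℝ) + 1 : ℝ) : ℂ) ^ (1 + ((c : ℂ) + u * I)) - ((X : ℝ) : ℂ) ^ (1 + ((c : ℂ) + u * I))) /
          (((c : ℂ) + u * I) * ((c : ℂ) + u * I + 1))‖ * (‖(∑ m ∈ Finset.Icc M₁ M₂, a m * (m : ℂ) ^ (-(1 / 2 + t * I)) * (m : ℂ) ^ (-((c : ℂ) + u * I)))‖ * ‖(∑ n ∈ Finset.Icc N₁ N₂, b n * (n : ℂ) ^ (-(1 / 2 + t * I)) * (n : ℂ) ^ (-((c : ℂ) + u * I)))‖) :=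
    integrable_finsetSum _ fun t _ => integrable_norm_kernel_mul_polys a b hM hN hX hc t
  have hκ : Integrable fun u : ℝ => ‖((((X : ℝ) + 1 : ℝ) : ℂ) ^ (1 + ((c : ℂ) + u * I)) - ((X : ℝ) : ℂ) ^ (1 + ((c : ℂ) + u * I))) /
          (((c : ℂ) + u * I) * ((c : ℂ) + u * I + 1))‖ := (integrable_kernel hXr hc).norm
  calc _ ≤ ∫ u : ℝ, (G * Real.sqrt A * Real.sqrt B) * ‖((((X : ℝ) + 1 : ℝ) : ℂ) ^ (1 + ((c : ℂ) + u * I)) - ((X : ℝ) : ℂ) ^ (1 + ((c : ℂ) + u * I))) /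
          (((c : ℂ) + u * I) * ((c : ℂ) + u * I + 1))‖ :=
        integral_mono hint (hκ.const_mul _) hpt
    _ = _ := integral_const_mul _ _

/-- **THE SEPARATED BILINEAR DISCRETE MEAN VALUE.** For coefficients `a` on `[M₁,M₂] ⊂ [1,N]`,
`b` on `[N₁,N₂] ⊂ [1,N]`, an integer threshold `X ≥ 2`, and `1`-spaced points `t ∈ S ⊂ [−2T,2T]`
with `N ≤ T`:
`Σ_t |Σ_{m,n: mn>X} a_m m^{−½−it} b_n n^{−½−it}| ≤ 186·T(1+log N)(1+log X)(Σ|a_m|²/m)^{1/2}(Σ|b_n|²/n)^{1/2}`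
— "this separation costs us a factor `log q`" + "Lemma 5.3" for each factor + Cauchy's
inequality, i.e. the printed `Σ_s|B(s)| ≪ T(log q)²(Σ τ²(m,χ)/m)^{1/2}(Σ τ²(n)/n)^{1/2}` in generic form.
[cite: ConreyIwaniec2002, §9 p. 20 (separation of variables in mn > q⁴); Lemma 5.3] -/
theorem sum_norm_hyperbolic_bilinear_le (a b : ℕ → ℂ) {N X M₁ M₂ N₁ N₂ : ℕ} (hM : 1 ≤ M₁)
    (hMN : M₂ ≤ N) (hN : 1 ≤ N₁) (hNN : N₂ ≤ N) (hX : 2 ≤ X) {T : ℝ} (hT : 0 < T)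
    (hNT : (N : ℝ) ≤ T) (S : Finset ℝ) (hmem : ∀ t ∈ S, |t| ≤ 2 * T)
    (hsep : ∀ t ∈ S, ∀ t' ∈ S, t ≠ t' → (1 : ℝ) ≤ |t - t'|) :
    ∑ t ∈ S, ‖(∑ m ∈ Finset.Icc M₁ M₂, ∑ n ∈ Finset.Icc N₁ N₂,
        if X < m * n then a m * (m : ℂ) ^ (-(1 / 2 + t * I)) * (b n * (n : ℂ) ^ (-(1 / 2 + t * I))) else 0)‖ ≤
      186 * T * (1 + Real.log N) * (1 + Real.log X) *
        Real.sqrt (∑ m ∈ Finset.Icc M₁ M₂, ‖a m‖ ^ 2 / m) *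
        Real.sqrt (∑ n ∈ Finset.Icc N₁ N₂, ‖b n‖ ^ 2 / n) := by
  have hX1 : 1 ≤ X := by omega
  have hXr2 : (2 : ℝ) ≤ (X : ℝ) := by exact_mod_cast hX
  have hmass := integral_norm_kernel_le hXr2
  set c : ℝ := 1 / Real.log ((X : ℝ) + 1) with hc
  have hc0 : 0 < c := by
    rw [hc]; exact div_pos one_pos (Real.log_pos (by linarith))
  set G : ℝ := 31 * T * (1 + Real.log N) with hG
  set A : ℝ := ∑ m ∈ Finset.Icc M₁ M₂, ‖a m‖ ^ 2 / m with hA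
  set B : ℝ := ∑ n ∈ Finset.Icc N₁ N₂, ‖b n‖ ^ 2 / n with hB
  have hlogN : 0 ≤ Real.log N := Real.log_natCast_nonneg N
  have hlogX : 0 ≤ Real.log X := Real.log_natCast_nonneg X
  have hG0 : 0 ≤ G := by positivity
  have hGAB : 0 ≤ G * Real.sqrt A * Real.sqrt B := by positivity
  -- pointwise, then summed
  have hsum : ∑ t ∈ S, ‖(∑ m ∈ Finset.Icc M₁ M₂, ∑ n ∈ Finset.Icc N₁ N₂,
        if X < m * n then a m * (m : ℂ) ^ (-(1 / 2 + t * I)) * (b n * (n : ℂ) ^ (-(1 / 2 + t * I))) else 0)‖ ≤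
      ∑ t ∈ S, ‖(∑ m ∈ Finset.Icc M₁ M₂, a m * (m : ℂ) ^ (-(1 / 2 + t * I)))‖ * ‖(∑ n ∈ Finset.Icc N₁ N₂, b n * (n : ℂ) ^ (-(1 / 2 + t * I)))‖ +
        1 / (2 * Real.pi) * ∑ t ∈ S, ∫ u : ℝ, ‖((((X : ℝ) + 1 : ℝ) : ℂ) ^ (1 + ((c : ℂ) + u * I)) - ((X : ℝ) : ℂ) ^ (1 + ((c : ℂ) + u * I))) /
          (((c : ℂ) + u * I) * ((c : ℂ) + u * I + 1))‖ * (‖(∑ m ∈ Finset.Icc M₁ M₂, a m * (m : ℂ) ^ (-(1 / 2 + t * I)) * (m : ℂ) ^ (-((c : ℂ) + u * I)))‖ * ‖(∑ n ∈ Finset.Icc N₁ N₂, b n * (n : ℂ) ^ (-(1 / 2 + t * I)) * (n : ℂ) ^ (-((c : ℂ) + u * I)))‖) := by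
    rw [Finset.mul_sum, ← Finset.sum_add_distrib]
    exact Finset.sum_le_sum fun t _ => norm_hyperbolic_sum_le a b hM hN hX1 hc0 t
  -- the diagonal part
  have hdiag : ∑ t ∈ S, ‖(∑ m ∈ Finset.Icc M₁ M₂, a m * (m : ℂ) ^ (-(1 / 2 + t * I)))‖ * ‖(∑ n ∈ Finset.Icc N₁ N₂, b n * (n : ℂ) ^ (-(1 / 2 + t * I)))‖ ≤ G * Real.sqrt A * Real.sqrt B := by
    have hCS := sum_norm_mul_le_sqrt S (fun t : ℝ => (∑ m ∈ Finset.Icc M₁ M₂, a m * (m : ℂ) ^ (-(1 / 2 + t * I)))) (fun t : ℝ => (∑ n ∈ Finset.Icc N₁ N₂, b n * (n : ℂ) ^ (-(1 / 2 + t * I))))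
    simp only [norm_mul] at hCS
    have ha := sum_norm_sq_twistedPoly_le a hM hMN hT hNT S hmem hsep (z := 0) (by simp)
    have hb := sum_norm_sq_twistedPoly_le b hN hNN hT hNT S hmem hsep (z := 0) (by simp)
    simp only [neg_zero, Complex.cpow_zero, mul_one] at ha hb
    refine hCS.trans ?_
    calc _ ≤ Real.sqrt (G * A) * Real.sqrt (G * B) := by gcongr
      _ = G * Real.sqrt A * Real.sqrt B := by
          rw [Real.sqrt_mul hG0, Real.sqrt_mul hG0]
          have := Real.mul_self_sqrt hG0
          calc Real.sqrt G * Real.sqrt A * (Real.sqrt G * Real.sqrt B)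
              = (Real.sqrt G * Real.sqrt G) * Real.sqrt A * Real.sqrt B := by ring
            _ = G * Real.sqrt A * Real.sqrt B := by rw [this]
  -- the off-diagonal part
  have hoff : ∑ t ∈ S, ∫ u : ℝ, ‖((((X : ℝ) + 1 : ℝ) : ℂ) ^ (1 + ((c : ℂ) + u * I)) - ((X : ℝ) : ℂ) ^ (1 + ((c : ℂ) + u * I))) /
          (((c : ℂ) + u * I) * ((c : ℂ) + u * I + 1))‖ * (‖(∑ m ∈ Finset.Icc M₁ M₂, a m * (m : ℂ) ^ (-(1 / 2 + t * I)) * (m : ℂ) ^ (-((c : ℂ) + u * I)))‖ * ‖(∑ n ∈ Finset.Icc N₁ N₂, b n * (n : ℂ) ^ (-(1 / 2 + t * I)) * (n : ℂ) ^ (-((c : ℂ) + u * I)))‖) ≤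
      (G * Real.sqrt A * Real.sqrt B) * (30 * (1 + Real.log X)) := by
    rw [← integral_finsetSum _ fun t _ => integrable_norm_kernel_mul_polys a b hM hN hX1 hc0 t]
    refine (integral_sum_norm_le a b hM hMN hN hNN hX1 hc0 hT hNT S hmem hsep).trans ?_
    exact mul_le_mul_of_nonneg_left hmass hGAB
  -- assemble: `1/(2π)·30 ≤ 5`, `1 ≤ 1 + log X`
  have hpi : 1 / (2 * Real.pi) * 30 ≤ 5 := by
    rw [div_mul_eq_mul_div, one_mul, div_le_iff₀ (by positivity)]
    linarith [Real.pi_gt_three]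
  have hkey : ∑ t ∈ S, ‖(∑ m ∈ Finset.Icc M₁ M₂, ∑ n ∈ Finset.Icc N₁ N₂,
        if X < m * n then a m * (m : ℂ) ^ (-(1 / 2 + t * I)) * (b n * (n : ℂ) ^ (-(1 / 2 + t * I))) else 0)‖ ≤ G * Real.sqrt A * Real.sqrt B * (1 + 5 * (1 + Real.log X)) := by
    have h1 : 1 / (2 * Real.pi) * ((G * Real.sqrt A * Real.sqrt B) * (30 * (1 + Real.log X))) ≤
        (G * Real.sqrt A * Real.sqrt B) * (5 * (1 + Real.log X)) := by
      have : 1 / (2 * Real.pi) * ((G * Real.sqrt A * Real.sqrt B) * (30 * (1 + Real.log X))) =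
          (G * Real.sqrt A * Real.sqrt B) * ((1 / (2 * Real.pi) * 30) * (1 + Real.log X)) := by
        ring
      rw [this]
      gcongr
    have h2 : 1 / (2 * Real.pi) * ∑ t ∈ S, ∫ u : ℝ, ‖((((X : ℝ) + 1 : ℝ) : ℂ) ^ (1 + ((c : ℂ) + u * I)) - ((X : ℝ) : ℂ) ^ (1 + ((c : ℂ) + u * I))) /
          (((c : ℂ) + u * I) * ((c : ℂ) + u * I + 1))‖ * (‖(∑ m ∈ Finset.Icc M₁ M₂, a m * (m : ℂ) ^ (-(1 / 2 + t * I)) * (m : ℂ) ^ (-((c : ℂ) + u * I)))‖ * ‖(∑ n ∈ Finset.Icc N₁ N₂, b n * (n : ℂ) ^ (-(1 / 2 + t * I)) * (n : ℂ) ^ (-((c : ℂ) + u * I)))‖) ≤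
        (G * Real.sqrt A * Real.sqrt B) * (5 * (1 + Real.log X)) :=
      (mul_le_mul_of_nonneg_left hoff (by positivity)).trans h1
    linarith [hsum, hdiag, h2]
  refine hkey.trans ?_
  rw [hG]
  have h6 : 1 + 5 * (1 + Real.log X) ≤ 6 * (1 + Real.log X) := by linarith
  calc 31 * T * (1 + Real.log ↑N) * Real.sqrt A * Real.sqrt B * (1 + 5 * (1 + Real.log ↑X))
      ≤ 31 * T * (1 + Real.log ↑N) * Real.sqrt A * Real.sqrt B * (6 * (1 + Real.log ↑X)) := by
        gcongr
    _ = 186 * T * (1 + Real.log ↑N) * (1 + Real.log ↑X) * Real.sqrt A * Real.sqrt B := by ring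

end HyperbolicSeparation

end Literature.NumberTheory.LFunctions

end
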